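import Summits.CriticalPhenomena.SAWScalingLimit.Theorems.NoFoldBound.Negative.BoundaryRayMkWalk
import Summits.CriticalPhenomena.SAWScalingLimit.Theorems.SAWDevelopingMapNoFoldBoundPeelStrip
import Summits.CriticalPhenomena.SAWScalingLimit.Theorems.SAWDevelopingMapNoFoldBoundPeelSimplyConnected

/-!
# Generator support for the flat certificate: walks from coordinate data in peeled strips

Helper file for the crux `NoFoldBound` (stmt-CriticalPhenomena-8296) of the route `SAWDevelopingMap`
(sub-problem `SAWScalingLimit` of `CriticalPhenomena`), programme FLAT / PEELED LP of the lead seats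
c9–c10 (`FLAT-LEAN-DESIGN.md` on the item, layer L3). The generated data files instantiate the landed
generic lemmas on the 42 peeled strips `stripDom T L ∖ K`; they need three small adaptors:

* `mem_stripDom_sdiff_map_iff` — `f ∈ stripDom T L ∖ K.map ofHV ↔ toHV f ∈ stripV T L ∖ K` (the
  coordinate description `hΩ` consumed by `BoundaryRay.exists_walk`);
* `exists_walk_to` — the variant of `BoundaryRay.exists_walk` whose final far end `om` may lie INSIDE
  the domain (only `om ∉ P` and `om ≠ ob` for a one-vertex `P` are needed): the prefix walks from the
  standard entrance to an interior door `{p, q}` are of this kind (adapted from `BoundaryRayMkWalk`);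
* `linked_map_ofHV` / `simplyConnected_stripDom_sdiff` — simple connectivity of `stripDom T L ∖ K.map ofHV`
  from linkage data inside `K` (each vertex of `K` joined in `K` to `hvOrigin`, which touches `wOut`).
-/

noncomputable section

open scoped Classical
open Literature.Probability.LatticeModels Literature.Probability.RandomPlanarGeometry.SAW
open Summit.CriticalPhenomena.SAWScalingLimit.Theorems.MassRatio.Negative
open Summit.CriticalPhenomena.SAWScalingLimit.Theorems.MassRatio.Renewal.BridgeDictionary (ofHV_injective)
open Summit.CriticalPhenomena.SAWScalingLimit.Theorems.NoFoldBound.Negative.BoundaryRay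
  (hexGraph_adj_ofHV nodup_edges_cons_concat ne_of_validWalk)

namespace Summit.CriticalPhenomena.SAWScalingLimit.Theorems.SAWDevelopingMapNoFoldBound.Peel

variable {T L : ℕ}

/-- Coordinate description of a peeled strip. -/
theorem mem_stripDom_sdiff_map_iff (K : Finset HV) (f : HexVertex) :
    f ∈ stripDom T L \ K.map ⟨ofHV, ofHV_injective⟩ ↔ toHV f ∈ HV.stripV T L \ K := by
  rw [Finset.mem_sdiff, Finset.mem_sdiff, mem_stripDom_iff, Finset.mem_map]
  constructor
  · rintro ⟨h1, h2⟩
    exact ⟨h1, fun hK => h2 ⟨toHV f, hK, ofHV_toHV f⟩⟩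
  · rintro ⟨h1, h2⟩
    refine ⟨h1, ?_⟩
    rintro ⟨w, hw, rfl⟩
    exact h2 (by simpa using hw)

/-- Membership of an `ofHV`-image in a peeled strip, in coordinates. -/
theorem ofHV_mem_stripDom_sdiff_map_iff (K : Finset HV) (w : HV) :
    ofHV w ∈ stripDom T L \ K.map ⟨ofHV, ofHV_injective⟩ ↔ w ∈ HV.stripV T L \ K := by
  rw [mem_stripDom_sdiff_map_iff, toHV_ofHV]

/-- Membership of an `ofHV`-image in the strip, in coordinates. -/
theorem ofHV_mem_stripDom_iff (w : HV) : ofHV w ∈ stripDom T L ↔ w ∈ HV.stripV T L := by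
  rw [mem_stripDom_iff, toHV_ofHV]

/-- **Explicit walks to a possibly interior mid-edge.** As `BoundaryRay.exists_walk`, but the far end
`om` of the final mid-edge need not be outside the domain: it must only be off the walk (and differ
from `ob` when the walk has one vertex). Used for the prefix walks `a → {p, q}` inside `K`. -/
theorem exists_walk_to {Ω : Finset HexVertex} {ΩHV : Finset HV} (hΩ : ∀ f, f ∈ Ω ↔ toHV f ∈ ΩHV)
    {ob om : HV} {P : List HV}
    (h : (P ≠ [] ∧ P.Nodup ∧ (ob :: (P ++ [om])).IsChain hvGraph.Adj ∧ (∀ w ∈ P, w ∈ ΩHV) ∧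
      ob ∉ ΩHV ∧ om ∉ P ∧ (P.length = 1 → ob ≠ om))) (hP : P ≠ []) :
    ∃ γ : HexMidEdgeSAW Ω s(ofHV ob, ofHV (P.head hP)) s(ofHV (P.getLast hP), ofHV om),
      γ.verts = P.map ofHV ∧
        γ.winding = Real.pi / 3 * (HV.pturn (ob :: (P ++ [om])) : ℝ) := by
  -- adapted from `BoundaryRayMkWalk.exists_walk`
  obtain ⟨-, hnd, hch, hsub, hob, homnot, h1⟩ := id h
  have hmemΩ : ∀ w : HV, ofHV w ∈ Ω ↔ w ∈ ΩHV := fun w => by rw [hΩ, toHV_ofHV]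
  have hobΩ : ofHV ob ∉ Ω := fun hh => hob ((hmemΩ ob).1 hh)
  have hchP : P.IsChain hvGraph.Adj := (List.isChain_cons.1 hch).2.left_of_append
  have hobP : hvGraph.Adj ob (P.head hP) := by
    have := (List.isChain_cons.1 hch).1 (P.head hP)
    apply this
    rw [List.head?_append, List.head?_eq_some_head hP]; rfl
  have hmapne : P.map ofHV ≠ [] := by simpa using hP
  set a : Sym2 HexVertex := s(ofHV ob, ofHV (P.head hP)) with ha
  set z : Sym2 HexVertex := s(ofHV (P.getLast hP), ofHV om) with hz
  have hobnot : ob ∉ P := fun hm => hob (hsub _ hm)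
  have hhead : (P.map ofHV).head? = some (ofHV (P.head hP)) := by
    rw [List.head?_map, List.head?_eq_some_head hP]; rfl
  have hlast' : (P.map ofHV).getLast? = some (ofHV (P.getLast hP)) := by
    rw [List.getLast?_map, List.getLast?_eq_some_getLast hP]; rfl
  -- no backtracking (the `om ∉ ΩHV` hypothesis of `ne_of_validWalk` is only used through `om ∉ P`)
  have hnb : ∀ (i : ℕ) (hi : i + 2 < (ob :: (P ++ [om])).length),
      (ob :: (P ++ [om]))[i] ≠ (ob :: (P ++ [om]))[i + 2]'hi := by
    have hd : (ob :: P).Nodup := List.nodup_cons.2 ⟨hobnot, hnd⟩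
    have ht : (P ++ [om]).Nodup := by
      rw [List.nodup_append]
      refine ⟨hnd, List.nodup_singleton _, fun x hx y hy => ?_⟩
      rw [List.mem_singleton] at hy
      subst hy
      exact fun hxy => homnot (hxy ▸ hx)
    intro i hi
    have hlen : (ob :: (P ++ [om])).length = P.length + 2 := by simp
    by_cases h2 : i + 2 < P.length + 1
    · have e1 : (ob :: (P ++ [om]))[i] = (ob :: P)[i]'(by simp; omega) := by
        show ((ob :: P) ++ [om])[i]'(by simp; omega) = _
        exact List.getElem_append_left (by simp; omega)
      have e2 : (ob :: (P ++ [om]))[i + 2]'hi = (ob :: P)[i + 2]'(by simp; omega) := by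
        show ((ob :: P) ++ [om])[i + 2]'(by simp; omega) = _
        exact List.getElem_append_left (by simp; omega)
      rw [e1, e2]
      intro heq
      have := (hd.getElem_inj_iff).1 heq
      omega
    · by_cases hi0 : i = 0
      · subst hi0
        have hP1 : P.length = 1 := by
          have := List.length_pos_of_ne_nil hP
          rw [hlen] at hi; omega
        obtain ⟨p, hp⟩ : ∃ p, P = [p] := List.length_eq_one_iff.1 hP1
        subst hp
        simpa using h1 rfl
      · obtain ⟨j, rfl⟩ : ∃ j, i = j + 1 := ⟨i - 1, by omega⟩
        have e1 : (ob :: (P ++ [om]))[j + 1] = (P ++ [om])[j]'(by simp; rw [hlen] at hi; omega) :=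
          List.getElem_cons_succ ..
        have e2 : (ob :: (P ++ [om]))[j + 1 + 2]'hi =
            (P ++ [om])[j + 2]'(by simp; rw [hlen] at hi; omega) :=
          List.getElem_cons_succ ..
        rw [e1, e2]
        intro heq
        have := (ht.getElem_inj_iff).1 heq
        omega
  let γ : HexMidEdgeSAW Ω a z :=
    { verts := P.map ofHV
      subset := fun v hv => by
        obtain ⟨w, hw, rfl⟩ := List.mem_map.1 hv
        exact (hmemΩ w).2 (hsub w hw)
      nodup := hnd.map ofHV_injective
      isChain := List.isChain_map_of_isChain ofHV (fun a b hab => (hexGraph_adj_ofHV a b).2 hab) hchP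
      head_mem := fun v hv => by
        rw [List.head?_map, List.head?_eq_some_head hP, Option.map_some, Option.some.injEq] at hv
        rw [← hv]; exact Sym2.mem_mk_right _ _
      getLast_mem := fun v hv => by
        rw [List.getLast?_map, List.getLast?_eq_some_getLast hP, Option.map_some,
          Option.some.injEq] at hv
        rw [← hv]; exact Sym2.mem_mk_left _ _
      eq_of_nil := fun hnil => absurd hnil hmapne
      edges_nodup := fun _ => by
        have e1 : (a :: List.zipWith (fun u w => s(u, w)) (P.map ofHV) (P.map ofHV).tail ++ [z]) =
            List.zipWith (fun u w => s(u, w)) (ofHV ob :: P.map ofHV ++ [ofHV om])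
              (ofHV ob :: P.map ofHV ++ [ofHV om]).tail := by
          rw [ha, hz, edges_cons_concat hhead hlast' (ofHV ob) (ofHV om)]
        rw [e1]
        refine nodup_edges_cons_concat (hnd.map ofHV_injective) ?_ ?_ hmapne ?_
        · exact fun hm => hobnot (by simpa [List.mem_map, ofHV_injective.eq_iff] using hm)
        · exact fun hm => homnot (by simpa [List.mem_map, ofHV_injective.eq_iff] using hm)
        · intro hl heq
          exact h1 (by simpa using hl) (ofHV_injective heq)
      fst_mem := by
        refine ⟨(SimpleGraph.mem_edgeSet hexGraph).2 ((hexGraph_adj_ofHV _ _).2 hobP),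
          ofHV (P.head hP), Sym2.mem_mk_right _ _, (hmemΩ _).2 (hsub _ (List.head_mem hP))⟩ }
  refine ⟨γ, rfl, ?_⟩
  have hne : γ.verts ≠ [] := hmapne
  have hlast : γ.verts.getLast hne = ofHV (P.getLast hP) := by
    show (P.map ofHV).getLast hmapne = ofHV (P.getLast hP)
    rw [List.getLast_map]
  rw [γ.winding_eq_winding_map ha hobΩ hne (e := ofHV om) (Or.inl ⟨hlast, rfl⟩)]
  have hlist : (ofHV ob :: (γ.verts ++ [ofHV om])).map hexCenter =
      ((ob :: (P ++ [om])).map fun w => HV.emb (HV.pos w)).map fun zz => (1 / 3 : ℂ) * zz + 0 := by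
    show (ofHV ob :: (P.map ofHV ++ [ofHV om])).map hexCenter = _
    simp only [List.map_cons, List.map_append, List.map_map, List.map_nil]
    have key : ∀ w : HV, hexCenter (ofHV w) = (1 / 3 : ℂ) * HV.emb (HV.pos w) + 0 := by
      intro w
      have e := HV.emb_pos_toHV (ofHV w)
      rw [toHV_ofHV] at e
      rw [e]; ring
    simp only [key, Function.comp_def]
  rw [hlist, winding_map_affine (by norm_num) 0, HV.winding_map_emb_pos _ hch hnb]

/-- Linkage inside the image of a coordinate set, from coordinate adjacency. -/
theorem linked_map_ofHV {K : Finset HV} {a b : HV} (ha : a ∈ K) (hb : b ∈ K) (hab : hvGraph.Adj a b) :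
    Linked (↑(K.map ⟨ofHV, ofHV_injective⟩) : Set HexVertex) (ofHV a) (ofHV b) :=
  linked_of_adj (by rw [Finset.coe_map]; exact Set.mem_image_of_mem _ (by simpa using ha))
    (by rw [Finset.coe_map]; exact Set.mem_image_of_mem _ (by simpa using hb)) ((hexGraph_adj_ofHV a b).2 hab)

/-- **Simple connectivity of a peeled strip from linkage data**: if every vertex of `K` is linked inside
`K` to `hvOrigin ∈ K`, then `stripDom T L ∖ K` is simply connected (`wOut`, outside the strip, is
adjacent to the origin). -/
theorem simplyConnected_stripDom_sdiff : ∀ {T L : ℕ} (K : Finset HV), hvOrigin ∈ K → (∀ k ∈ K, Summit.CriticalPhenomena.SAWScalingLimit.Theorems.MassRatio.Negative.Linked (↑(K.map ⟨ofHV, Summit.CriticalPhenomena.SAWScalingLimit.Theorems.MassRatio.Renewal.BridgeDictionary.ofHV_injective⟩) : Set HexVertex) (ofHV k) (ofHV hvOrigin)) → hexDomainSimplyConnected (stripDom T L \ K.map ⟨ofHV, Summit.CriticalPhenomena.SAWScalingLimit.Theorems.MassRatio.Renewal.BridgeDictionary.ofHV_injective⟩) := by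
  intro T L K hO hlink
  refine hexDomainSimplyConnected_sdiff (stripDom_simplyConnected T L) fun k hk => ?_
  obtain ⟨k', hk', rfl⟩ := Finset.mem_map.1 hk
  refine ⟨ofHV hvOrigin, Finset.mem_map_of_mem _ hO, ofHV HV.wOut, ?_, ?_, hlink k' hk'⟩
  · rw [ofHV_mem_stripDom_iff]; exact HV.wOut_not_mem_stripV T L
  · exact (hexGraph_adj_ofHV _ _).2 HV.adj_wOut_hvOrigin.symm

end Summit.CriticalPhenomena.SAWScalingLimit.Theorems.SAWDevelopingMapNoFoldBound.Peel
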